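import Mathlib
import Summits.ResolutionOfSingularities.ResolutionOfSingularities.Theorems.WeightedInvariantLocalWeightedDropPolyDescentCompare
import Summits.ResolutionOfSingularities.ResolutionOfSingularities.Theorems.WeightedInvariantLocalWeightedDropWildMonicPolyhedronShearColumn
import Summits.ResolutionOfSingularities.ResolutionOfSingularities.Theorems.WeightedInvariantLocalWeightedDropPureDescentShearBeta
import Summits.ResolutionOfSingularities.ResolutionOfSingularities.Theorems.WeightedInvariantLocalWeightedDropMonicDescentPrepInvariance

/-!
# `WeightedInvariant.LocalWeightedDrop`, stub S3ρ: the monic polyhedron descent — the slotwise SHEAR keeps the leftmost column; the PREPARED SHEAR keeps `(α, β)`;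
# `β` IS NON-INCREASING ALONG Σ**_d (piece ρ-T, part 2; CJS Lemma 13.6, Prop. 13.5 / Lemma 13.4 (3))

Crux item stmt-ResolutionOfSingularities-8899 `LocalWeightedDrop` (route `ResolutionOfSingularities/WeightedInvariant`), registered skeleton v30
(09f812eb3be8b7d8), stub S3ρ `stub_wildMonicSurfaceReductionWon`.  [OURS · L1 W4.3, chain w43, lead prover (gen 3); a LINE UNDER THE STUB: the
monic polyhedron descent (second key to S3ρ, memo `L/res-L1-w43-lead-1/g3/S3RHO-CJS-MEMO.md`, line file `poly_descent_line_v1.lean` evidence on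
stmt-8899), MODEL Cossart–Jannsen–Saito LNM 2270 Ch. 8/11–13 for `J = (y^d + Σ_{j<d} A_j y^j)`, `e = 2`, `k = k̄`; nothing here is a statement of
any manuscript.]

Given Hironaka's vertex preparation (ρ-P) and minimality (ρ-M) as HYPOTHESES (`hprep`, `hmin` — the line's sub-stubs `stub_polyPrep`, `stub_polyMinimality`):
* the `u₂`-shear keeps every column `P₀ ≤ α` slot by slot, hence `α`, `β`, the lex-min vertex and its vertex polynomial — IMPORTED from
  res-D-pv-058's `…WildMonicPolyhedronShearColumn` (p513230: `coeff_slotShear_of_le_alphaL`, `alphaL/betaL_newtonSet_slotShear`,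
  `vertexCoeff_shearT_of_le_alphaL`, `solvable_shearT_iff_of_le_alphaL`); here only `shearT_apply`, `isPosT_shearT`, `isPermissibleOneT_shearT`;
* `alphaL_betaL_prep_shearT` — the PREPARED sheared label of a well-prepared position keeps `(α, β)` (persistence of the non-solvable lex-min vertex +
  minimality); degree-2 instance `MonicDescent.alphaL_betaL_prep_shear`;
* `betaL_succT_le` — β non-increasing along Σ**_d with the β-neutral steps classified (`IsNeutralStepT`); `exists_neutral_tailT` — β-stabilisation.
-/

set_option linter.dupNamespace false -- mandated namespace of this single-conjunct summit

noncomputable section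

namespace Summit.ResolutionOfSingularities.ResolutionOfSingularities.Theorems

namespace PolyDescent

open MvPowerSeries MonicDescent WildMonic Literature.RingTheory.TwoVariableSeries Literature.AlgebraicGeometry.Resolution

variable {k : Type} [Field k]

/-! ## The slotwise `u₂`-shear of a tuple -/

/-- Components of the sheared tuple. -/
theorem shearT_apply {d : ℕ} (h : MvPowerSeries (Fin 2) k) (A : Fin d → MvPowerSeries (Fin 2) k) (j : Fin d) :
    shearT h A j = shear h (A j) := rfl

/-- The shear of a position is a position. -/
theorem isPosT_shearT {d : ℕ} (h : MvPowerSeries (Fin 2) k) {A : Fin d → MvPowerSeries (Fin 2) k} (hA : IsPosT d A) :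
    IsPosT d (shearT h A) :=
  fun j => lt_of_lt_of_le (hA j) (PureDescent.order_le_order_shear h (A j))

/-- `V(y,u₁)`-permissibility is kept by the shear. -/
theorem isPermissibleOneT_shearT {d : ℕ} (h : MvPowerSeries (Fin 2) k) {A : Fin d → MvPowerSeries (Fin 2) k} (hA : IsPermissibleOneT d A) :
    IsPermissibleOneT d (shearT h A) :=
  fun j => le_fst_shear_of_le_fst h (A j) (d - (j : ℕ)) (hA j)

section PrepShear

variable {d : ℕ}
  (hmin : ∀ (B : Fin d → MvPowerSeries (Fin 2) k) (ψ : MvPowerSeries (Fin 2) k), WellPrepared d B → IsPosT d B → constantCoeff ψ = 0 →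
    ∀ w : Fin 2 → ℕ, (∀ i, 0 < w i) → ∀ P ∈ newtonSet B, ∃ Q ∈ newtonSet (shift d B ψ), Finsupp.weight w Q ≤ Finsupp.weight w P)
include hmin

/-- THE PREPARED SHEARED LABEL of a well-prepared position with non-empty Newton set has non-empty Newton set, the SAME `α` and the SAME `β`
(the lex-min vertex is non-solvable, survives the shear with its vertex polynomial, hence persists; the other inequality is minimality).
Degree-2 instance: `MonicDescent.alphaL_betaL_prep_shear`. -/
theorem alphaL_betaL_prep_shearT {A : Fin d → MvPowerSeries (Fin 2) k} {h ψ : MvPowerSeries (Fin 2) k} (hWP : WellPrepared d A)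
    (hne : (newtonSet A).Nonempty) (hprep : IsPrepRecentring d (shearT h A) ψ) :
    (newtonSet (shift d (shearT h A) ψ)).Nonempty ∧ alphaL (newtonSet (shift d (shearT h A) ψ)) = alphaL (newtonSet A) ∧
      betaL (newtonSet (shift d (shearT h A) ψ)) = betaL (newtonSet A) := by
  obtain ⟨hψ0, hposB, hWPB, hpers⟩ := hprep
  set S := shearT h A with hS
  set B := shift d S ψ with hB
  have hαS := alphaL_newtonSet_slotShear h hne
  have hβS := betaL_newtonSet_slotShear h hne
  obtain ⟨P, hP, hP0, hP1⟩ := exists_eq_betaL hne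
  have hPv : IsVertex (newtonSet A) P := isVertex_lexMin hP hP0 hP1
  have hPns : ¬ Solvable d A P := hWP P hPv
  have hPS : P ∈ newtonSet S := (mem_newtonSet_slotShear_iff_of_le_alphaL h A hP0.le).mpr hP
  have hPvS : IsVertex (newtonSet S) P := isVertex_lexMin hPS (by rw [hαS]; exact hP0) (by rw [hβS]; exact hP1)
  have hPnsS : ¬ Solvable d S P := fun hs => hPns ((solvable_shearT_iff_of_le_alphaL h A hP0.le).mp hs)
  obtain ⟨hPvB, -⟩ := hpers P hPvS hPnsS
  have hPB : P ∈ newtonSet B := hPvB.1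
  have hneB : (newtonSet B).Nonempty := ⟨P, hPB⟩
  -- minimality, re-centring `B` back to `S`
  have hback : shift d B (-ψ) = S := shift_shift_neg d S ψ
  have hψ' : constantCoeff (-ψ) = 0 := by rw [map_neg, hψ0, neg_zero]
  have hαle : alphaL (newtonSet S) ≤ alphaL (newtonSet B) := by
    have h := alphaL_shift_le hmin hWPB hposB hψ' hneB
    rwa [hback] at h
  have hα : alphaL (newtonSet B) = alphaL (newtonSet A) := by
    apply le_antisymm
    · rw [← hP0]; exact alphaL_le hPB
    · rw [← hαS]; exact hαle
  refine ⟨hneB, hα, ?_⟩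
  apply le_antisymm
  · rw [← hP1]; exact betaL_le hPB (by rw [hα]; exact hP0)
  · have h := betaL_shift_le hmin hWPB hposB hψ' hneB (by rw [hback, hαS, hα])
    rw [hback, hβS] at h
    exact h

end PrepShear

/-! ## `β` is non-increasing along Σ**_d; the β-neutral steps; β-stabilisation -/

/-- If `V(y,u₁)` is NOT permissible then `α < d!`. -/
theorem alphaL_lt_factorial_of_not_isPermissibleOneT {d : ℕ} {A : Fin d → MvPowerSeries (Fin 2) k} (h : ¬ IsPermissibleOneT d A) :
    alphaL (newtonSet A) < d.factorial := by
  unfold IsPermissibleOneT at h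
  push Not at h
  obtain ⟨j, e, he, hlt⟩ := h
  calc alphaL (newtonSet A) ≤ slotWeight d j * e 0 := alphaL_le_slotWeight_mul A j he
    _ < slotWeight d j * (d - (j : ℕ)) := Nat.mul_lt_mul_of_pos_left hlt (slotWeight_pos j)
    _ = d.factorial := slotWeight_mul_sub j

/-- The β-NEUTRAL STEPS of Σ**_d from `X` to `Y`. -/
def IsNeutralStepT (d : ℕ) (X Y : Fin d → MvPowerSeries (Fin 2) k) : Prop :=
  (IsPermissibleOneT d X ∧ Y = divOneT d X) ∨
  (¬ IsPermissibleOneT d X ∧ ¬ IsPermissibleTwoT d X ∧ ¬ HasGraphCurveT d X ∧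
    (Y = blowOneT d X ∨ ∃ c : k, c ≠ 0 ∧ Y = blowOneT d (prep d (shearT (C c) X))))

section Beta

variable {d : ℕ}
  (hprep : ∀ A : Fin d → MvPowerSeries (Fin 2) k, IsPosT d A → ∃ ψ : MvPowerSeries (Fin 2) k, IsPrepRecentring d A ψ)
  (hmin : ∀ (B : Fin d → MvPowerSeries (Fin 2) k) (ψ : MvPowerSeries (Fin 2) k), WellPrepared d B → IsPosT d B → constantCoeff ψ = 0 →
    ∀ w : Fin 2 → ℕ, (∀ i, 0 < w i) → ∀ P ∈ newtonSet B, ∃ Q ∈ newtonSet (shift d B ψ), Finsupp.weight w Q ≤ Finsupp.weight w P)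
include hprep hmin

/-- `β` IS NON-INCREASING ALONG Σ**_d (given (ρ-P) and (ρ-M)), and the β-neutral steps are the blow-up of the permissible `V(y,u₁)` or a point move
answered by `(1:0)` / `(1:λ)` (CJS Prop. 13.5 + Lemma 13.4 (3); degree-2 `MonicDescent.betaL_succLabels_le`, pure `PureDescent.betaL_succ_le`). -/
theorem betaL_succT_le (A : Fin d → MvPowerSeries (Fin 2) k) (hWP : WellPrepared d A) (hpos : IsPosT d A)
    (hne : (newtonSet A).Nonempty) (A' : Fin d → MvPowerSeries (Fin 2) k) (hA' : A' ∈ succT d A) :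
    betaL (newtonSet A') ≤ betaL (newtonSet A) ∧ (betaL (newtonSet A') = betaL (newtonSet A) → IsNeutralStepT d A A') := by
  have hL : 0 < d.factorial := Nat.factorial_pos d
  have hsum := factorial_le_sum_of_isPosT hpos
  have hsum1 := factorial_lt_sum_of_isPosT hpos
  by_cases h1 : IsPermissibleOneT d A
  · rw [succT_of_isPermissibleOneT h1] at hA'
    rcases hA' with rfl
    rw [newtonSet_divOneT A h1, betaL_image_shift (shiftOneF_fst h1) (shiftOneF_snd d A) hne]
    exact ⟨le_rfl, fun _ => Or.inl ⟨h1, rfl⟩⟩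
  by_cases h2 : IsPermissibleTwoT d A
  · rw [succT_of_isPermissibleTwoT h1 h2] at hA'
    rcases hA' with rfl
    have hβ := betaL_image_shift₂_add (shiftTwoF_fst d A) (shiftTwoF_snd h2) hne
    rw [newtonSet_divTwoT A h2]
    exact ⟨by omega, fun h => by omega⟩
  by_cases h3 : HasGraphCurveT d A
  · rw [succT_of_hasGraphCurveT h1 h2 h3] at hA'
    rcases hA' with rfl
    set h := graphShearT d A with hh
    obtain ⟨ψ', -, hψ'0, hperm'⟩ := graphShearT_spec h3
    have hposS : IsPosT d (shearT h A) := isPosT_shearT h hpos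
    have hprepS : IsPrepRecentring d (shearT h A) (prepPsi d (shearT h A)) := isPrepRecentring_prepPsi (hprep _ hposS)
    obtain ⟨hneB, hαB, hβB⟩ := alphaL_betaL_prep_shearT hmin hWP hne hprepS
    set B := prep d (shearT h A) with hB
    have hBdef : B = shift d (shearT h A) (prepPsi d (shearT h A)) := rfl
    have hperm : IsPermissibleTwoT d B := by
      rw [hBdef]
      exact isPermissibleTwoT_of_wellPrepared_shift hmin hperm' hprepS.1 hψ'0 hprepS.2.2.1 hprepS.2.1
    rw [hBdef] at hperm
    have hβ := betaL_image_shift₂_add (shiftTwoF_fst d _) (shiftTwoF_snd hperm) hneB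
    rw [hBdef, newtonSet_divTwoT _ hperm]
    rw [hβB] at hβ
    exact ⟨by omega, fun h => by omega⟩
  -- the point move
  rw [succT_of_point h1 h2 h3] at hA'
  have hα : alphaL (newtonSet A) < d.factorial := alphaL_lt_factorial_of_not_isPermissibleOneT h1
  rcases hA' with (rfl | rfl) | ⟨c, hc0, rfl⟩
  · rw [newtonSet_blowOneT A hpos]
    exact ⟨betaL_image_psiC_le hsum hne, fun _ => Or.inr ⟨h1, h2, h3, Or.inl rfl⟩⟩
  · rw [newtonSet_blowTwoT A hpos, betaL_image_phiEC hsum hne]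
    obtain ⟨P, hP, hP0, hP1⟩ := exists_eq_betaL hne
    have h3P := hsum1 P hP
    rw [hP0, hP1] at h3P
    exact ⟨by omega, fun h => by omega⟩
  · have hposS : IsPosT d (shearT (C c) A) := isPosT_shearT (C c) hpos
    have hprepS : IsPrepRecentring d (shearT (C c) A) (prepPsi d (shearT (C c) A)) := isPrepRecentring_prepPsi (hprep _ hposS)
    obtain ⟨hneB, hαB, hβB⟩ := alphaL_betaL_prep_shearT hmin hWP hne hprepS
    have hBdef : prep d (shearT (C c) A) = shift d (shearT (C c) A) (prepPsi d (shearT (C c) A)) := rfl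
    have hposB : IsPosT d (prep d (shearT (C c) A)) := hprepS.2.1
    have hsumB := factorial_le_sum_of_isPosT hposB
    refine ⟨?_, fun _ => Or.inr ⟨h1, h2, h3, Or.inr ⟨c, hc0, rfl⟩⟩⟩
    rw [newtonSet_blowOneT _ hposB]
    exact le_trans (betaL_image_psiC_le hsumB hneB) hβB.le

/-- β-STABILISATION along an infinite Σ**_d-chain of well-prepared positions with non-empty Newton set. -/
theorem exists_neutral_tailT (A : ℕ → (Fin d → MvPowerSeries (Fin 2) k))
    (hA : ∀ m, WellPrepared d (A m) ∧ IsPosT d (A m) ∧ (newtonSet (A m)).Nonempty ∧ A (m + 1) ∈ succT d (A m)) :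
    ∃ M : ℕ, ∀ m, M ≤ m → betaL (newtonSet (A m)) = betaL (newtonSet (A M)) ∧ IsNeutralStepT d (A m) (A (m + 1)) := by
  set f : ℕ → ℕ := fun m => betaL (newtonSet (A m)) with hf
  have hstep : ∀ m, f (m + 1) ≤ f m ∧ (f (m + 1) = f m → IsNeutralStepT d (A m) (A (m + 1))) := by
    intro m
    obtain ⟨hwp, hpos, hne, hsucc⟩ := hA m
    exact betaL_succT_le hprep hmin (A m) hwp hpos hne (A (m + 1)) hsucc
  have hanti : ∀ m n, m ≤ n → f n ≤ f m := by
    intro m n hmn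
    induction n, hmn using Nat.le_induction with
    | base => exact le_rfl
    | succ n _ ih => exact le_trans (hstep n).1 ih
  obtain ⟨M, hM⟩ : ∃ M, ∀ n, f M ≤ f n := by
    have hne : (Set.range f).Nonempty := ⟨f 0, 0, rfl⟩
    obtain ⟨M, hMv⟩ : sInf (Set.range f) ∈ Set.range f := Nat.sInf_mem hne
    exact ⟨M, fun n => by rw [hMv]; exact Nat.sInf_le ⟨n, rfl⟩⟩
  refine ⟨M, fun m hm => ?_⟩
  have hfm : f m = f M := le_antisymm (hanti M m hm) (hM m)
  have hfm1 : f (m + 1) = f M := le_antisymm (hanti M (m + 1) (by omega)) (hM (m + 1))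
  exact ⟨hfm, (hstep m).2 (by rw [hfm1, hfm])⟩

end Beta

end PolyDescent

end Summit.ResolutionOfSingularities.ResolutionOfSingularities.Theorems

end
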